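import Literature.MathematicalPhysics.QuantumFieldTheory.BalabanImbrieJaffe1984to88.BIJ88ConnectedGraphFillingBound
import Literature.MathematicalPhysics.QuantumFieldTheory.BalabanImbrieJaffe1984to88.BIJ88ConnectedGraphKP310

/-!
# `BalabanImbrieJaffe1984to88.BIJ88ConnectedGraphFillingVsupp` — T. Bałaban, J. Imbrie, A. Jaffe, *Effective action and cluster properties of
the abelian Higgs model*, Commun. Math. Phys. **114** (1988) 257–315 [BalabanImbrieJaffe1988], Sect. 5.14, pp. 309–310 [PDF 53–54]: **THE "FILL X"
PIECES OF DISPLAY 3 IN THE CLUSTER-CONFIGURATION GAS OF (5.14.3)** — the bookkeeping of record for the expansion (p25 g10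
`BIJ88Expansion5143Ordered`: virtual supports `(polysOf W).image (cvsupp adj W)`, localization `locv loc`, activity `wv g`; hard core of the
virtual supports = the printed constraint *"{X_γ},{Y_δ} nonoverlapping"* with polymers of ≥ 2 cubes non-abutting).  p. 310: *"Here W₆^{(k)′}(X) is
obtained by summing only over {X_γ}, (Y₁, …, Y_B) which fill X … It is now a standard exercise to estimate the expansion, using (5.14.4). The result
is |W₆^{(k)′}(X)| ≤ (e^β(L^kε/ε₀)^{1/4−α})^{n̄+1+β′|X|}."*

statement-level skeleton of published theorems with citation tags; proofs where landed; nothing here is a claim about the Yang–Mills mass gap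

PDF held: `paper:balaban1988-cmp114-bij-abelian-higgs-effective-action` (journal page = PDF page + 256); pp. 309–310 = PDF 53–54 read this generation.

WHAT IS REPRODUCED (unit `lit-balaban-p36`, generation 13 of the Phase-2 proof seat p36, file 4 of the display-4 chain; SKELETON rows
**C2.Claim@310** (the definition of `W₆′` / display 4 / the *"standard exercise"* sentence, member) and **C2.Eq5.14.3-5.14.4** ((5.14.4) consumed by
name, member) of `HOME/lit-balaban-r16/ROWS-C2-part2.md`; owner r16, heads untouched; HOME `run/shared/lean/pub/lit-balaban/`).  Setting of p36 g11
`BIJ88ConnectedGraphKP310` verbatim (cubes `ι`, slots `S`, abutting relation `adj` symmetric of degree `≤ Δ` via `nbr`, volume `W`, localization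
`loc : S → ι`, activity `g : Finset S → Finset ι → ℝ`), cube projection `U = cubesOf`.  Theorems only (0 definitions):
* §1 THE SUB-FAMILIES ARE THE SUB-REGION GASES: `filter_vsupp_cubesOf_subset` (the virtual supports of polymers of `W` with cubes in `X ⊆ W` are the
  `W`-coded polymers of `X`), **`Tsum_vsupp_subfamily_eq`** (their truncated functions are those of the gas of the region `X` itself — p36 g13
  `BIJ88ConnectedGraphFilling.Tsum_image_congr`: same overlaps `disjoint_vsupp_iff`, same incidences `inl_mem_vsupp_iff`, same activities `wv_vsupp`),
  `Tsum_vsupp_eq_zero_of_not_mem` (a slot outside `X` ⇒ the truncated function of the `X`-gas vanishes), `TsumFill_vsupp_eq_zero_of_not_mem`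
  (*"summing over {γ_j} with suppt(d/dt)_{γ_j} ⊂ X"*), **`TsumFill_vsupp_eq_cornerSum`**: THE `X`-PIECE OF THE TRUNCATED FUNCTION IS THE CORNER SUM
  `Σ_{X'⊆X} (−1)^{|X∖X'|} T[X'-gas]` OF THE TRUNCATED FUNCTIONS OF THE SUB-REGION GASES.
* §2 THE STANDARD EXERCISE WITH `|X|`-DECAY from an activity bound `|g(H,Y)| ≤ M^{|H|}·σ^{|Y|}·q^{|Y|}` vanishing off connected polymers
  (`abs_wv_le_decay`, `vertexHyp_vsupp_sub`, `rootHyp_vsupp_sub` — root constant `∝ |X|`, not `|W|` —, `summable_norm_Tord_vsupp_sub`,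
  **`abs_TsumFill_vsupp_le`**: `|T^{fill X}(b)| ≤ q^{|X|}·M^{|b|}·|b|!·4e²σ(Δ+1)·|X|`, `summable_norm_TordFill_vsupp`).
* §3 FROM THE LEAF (5.14.4) in gen 5's regime `16(Δ+1)²θ^{β′/2}e² ≤ 1` with `M = θ^{1−β′}`, `σ = q = θ^{β′/2}` (`regime_split_half`,
  `abs_prime_g3_le_of_ineq5144_half`): **`TsumFill_vsupp_eq_cornerSum_of_ineq5144`**, `summable_norm_Tord_vsupp_sub_of_ineq5144`,
  **`abs_TsumFill_vsupp_le_of_ineq5144`** (`|T^{fill X}(b)| ≤ (θ^{β′/2})^{|X|}·(θ^{1−β′})^{|b|}·|b|!·4e²θ^{β′/2}(Δ+1)·|X|` — the `|X|`-decay of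
  the printed "result" in the bookkeeping of record), `summable_norm_TordFill_vsupp_of_ineq5144`.
HONEST SCOPE: (a) (5.14.4) is NOT proved — typed leaf `Ineq5144` (row C2.Eq5.14.3-5.14.4), hypothesis shape as in p36 g11; (b) constants not
optimized; (c) `W₆′` itself (the `t`-integral, the assignment sum) is the sibling `BIJ88W6PrimeVsupp`.  0 `sorry`, 0 definitions, 0 `Prop` facts
(D-0026); imports `BIJ88ConnectedGraphFillingBound` (p36 g13), `BIJ88ConnectedGraphKP310` (p36 g11); modifies nothing.  NOT summit progress; NOT
continuum; NOT Clay.  Cell `lit-balaban` Phase 2, seat p36 gen 13 (row owner r16, referee ref-5).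
-/

noncomputable section

namespace Literature.MathematicalPhysics.QuantumFieldTheory.BalabanImbrieJaffe1984to88.BIJ88ConnectedGraphFillingVsupp

open Finset
open Literature.Probability.LatticeModels (IsRConnected Touches kpWeight kpWeight_nonneg sum_kpWeight_le_of_touches)
open BIJ88ConnectedGraphResummation (Tord Tsum)
open BIJ88ConnectedGraphTreeBound (summable_norm_Tord_of_treeHyp)
open BIJ88ConnectedGraphFilling (TsumFill TordFill TsumFill_eq_cornerSum TsumFill_eq_zero_of_not_mem Tsum_eq_zero_of_not_cov
  Tsum_image_congr Tord_image_congr cornerSum_congr)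
open BIJ88ConnectedGraphFillingBound (summable_norm_TordFill_of_treeHyp abs_TsumFill_le_of_treeHyp)
open BIJ88ConnectedGraphKP310 (kpWeight_mul_pow_le vertexHyp_vsupp abs_prime_g3_le_of_ineq5144 prime_g3_eq_zero_of_not_isRConnected)
open BIJ88Clusters5134 (cornerSum)
open BIJ88Expansion5143 (prime g3)
open BIJ88Expansion5143Ordered (polysOf cinc cvsupp locv wv cubesOf cubesOf_vsupp wv_vsupp disjoint_vsupp_iff)
open BIJ88VirtualSupports310 (vsupp_injective inl_mem_vsupp_iff)
open BIJ88Expansion5143Obs (mem_polysOf)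
open BIJ88Expansion5143KP (touches_of_cinc)
open BIJ88Ineq5113Covering (cubeSys)
open BIJ88Sect5StatementsPart2 (Ineq5144)

/-! ## §1 The sub-families of the clusters inside `X` are the gases of the sub-regions `X` -/

section SubRegion

variable {ι : Type*} [DecidableEq ι] [Fintype ι] {S : Type*} [DecidableEq S] [Fintype S] {adj : ι → ι → Prop} [DecidableRel adj]
  {W : Finset ι} {loc : S → ι} {g : Finset S → Finset ι → ℝ}

omit [DecidableEq ι] [Fintype ι] [DecidableEq S] [Fintype S] [DecidableRel adj] in
/-- the polymers of `X ⊆ W` are polymers of `W`. [cite: BalabanImbrieJaffe1988, p.309 (Sect. 5.14)] -/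
theorem polysOf_mono {X : Finset ι} (hXW : X ⊆ W) : polysOf X ⊆ polysOf W := fun Y hY => by
  rw [mem_polysOf] at hY ⊢
  exact ⟨hY.1.trans hXW, hY.2⟩

omit [DecidableEq S] [Fintype S] [DecidableRel adj] in
/-- a site of a slot lies in a set of virtual cubes iff its cube lies in the cube content. [cite: BalabanImbrieJaffe1988, p.310 (Sect. 5.14)] -/
theorem locv_mem_iff (j : S) (Zv : Finset (ι ⊕ (Finset ι × Finset ι))) : locv loc j ∈ Zv ↔ loc j ∈ cubesOf Zv := by
  simp only [locv, cubesOf, mem_filter, mem_univ, true_and]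

omit [DecidableEq S] [Fintype S] in
/-- **the virtual supports of the polymers of `W` with cube content in `X ⊆ W` are the `W`-coded polymers of `X`**.
[cite: BalabanImbrieJaffe1988, p.310 (Sect. 5.14)] -/
theorem filter_vsupp_cubesOf_subset {X : Finset ι} (hXW : X ⊆ W) :
    ((polysOf W).image (cvsupp adj W)).filter (fun Zv => cubesOf Zv ⊆ X) = (polysOf X).image (cvsupp adj W) := by
  ext Zv
  simp only [mem_filter, mem_image]
  constructor
  · rintro ⟨⟨Y, hY, rfl⟩, hsub⟩
    rw [cubesOf_vsupp] at hsub
    exact ⟨Y, mem_polysOf.2 ⟨hsub, (mem_polysOf.1 hY).2⟩, rfl⟩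
  · rintro ⟨Y, hY, rfl⟩
    refine ⟨⟨Y, polysOf_mono hXW hY, rfl⟩, ?_⟩
    rw [cubesOf_vsupp]
    exact (mem_polysOf.1 hY).1

/-- **THE SUB-FAMILY IS THE SUB-REGION GAS**: the truncated functions over the `W`-coded polymers of `X ⊆ W` equal those over the `X`-coded polymers of
`X` — the two codings have the same overlaps (`cinc`), the same slot incidences and the same activities (p36 g13 `Tsum_image_congr`).
[cite: BalabanImbrieJaffe1988, p.310 (Sect. 5.14)] -/
theorem Tsum_vsupp_subfamily_eq {X : Finset ι} (hXW : X ⊆ W) (K : Finset S) :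
    Tsum ((polysOf X).image (cvsupp adj W)) (locv loc) (wv g) K = Tsum ((polysOf X).image (cvsupp adj X)) (locv loc) (wv g) K :=
  Tsum_image_congr (polysOf X) (fun _ _ _ _ h => vsupp_injective h) (fun _ _ _ _ h => vsupp_injective h)
    (fun Y hY Y' hY' => by rw [disjoint_vsupp_iff (polysOf_mono hXW hY) (polysOf_mono hXW hY'), disjoint_vsupp_iff hY hY'])
    (fun Y _ j => by simp only [locv, inl_mem_vsupp_iff]) (fun Y _ H => by rw [wv_vsupp, wv_vsupp]) K

/-- degree-wise. [cite: BalabanImbrieJaffe1988, p.310 (Sect. 5.14)] -/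
theorem Tord_vsupp_subfamily_eq {X : Finset ι} (hXW : X ⊆ W) (m : ℕ) (K : Finset S) :
    Tord ((polysOf X).image (cvsupp adj W)) (locv loc) (wv g) m K = Tord ((polysOf X).image (cvsupp adj X)) (locv loc) (wv g) m K :=
  Tord_image_congr (polysOf X) (fun _ _ _ _ h => vsupp_injective h) (fun _ _ _ _ h => vsupp_injective h)
    (fun Y hY Y' hY' => by rw [disjoint_vsupp_iff (polysOf_mono hXW hY) (polysOf_mono hXW hY'), disjoint_vsupp_iff hY hY'])
    (fun Y _ j => by simp only [locv, inl_mem_vsupp_iff]) (fun Y _ H => by rw [wv_vsupp, wv_vsupp]) m K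

/-- **a slot located outside `X` ⇒ the truncated function of the `X`-gas vanishes** (no polymer of `X` covers it).
[cite: BalabanImbrieJaffe1988, p.309 (Sect. 5.14)] -/
theorem Tsum_vsupp_eq_zero_of_not_mem {X V : Finset ι} {K : Finset S} (h : ∃ j ∈ K, loc j ∉ X) :
    Tsum ((polysOf X).image (cvsupp adj V)) (locv loc) (wv g) K = 0 := by
  obtain ⟨j, hj, hjX⟩ := h
  refine Tsum_eq_zero_of_not_cov _ _ _ ⟨j, hj, fun Zv hZv hjZ => hjX ?_⟩
  obtain ⟨Y, hY, rfl⟩ := mem_image.1 hZv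
  exact (mem_polysOf.1 hY).1 ((inl_mem_vsupp_iff (supp := id)).1 hjZ)

/-- **the `X`-piece vanishes unless every slot's cube lies in `X`** (*"summing over {γ_j} with suppt(d/dt)_{γ_j} ⊂ X"*).
[cite: BalabanImbrieJaffe1988, p.310 (Sect. 5.14)] -/
theorem TsumFill_vsupp_eq_zero_of_not_mem {X : Finset ι} {K : Finset S} (h : ∃ j ∈ K, loc j ∉ X) :
    TsumFill ((polysOf W).image (cvsupp adj W)) (locv loc) (wv g) cubesOf X K = 0 :=
  TsumFill_eq_zero_of_not_mem _ _ _ _ (cub := loc) (fun Zv _ j hj => (locv_mem_iff j Zv).1 hj) h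

/-- **THE `X`-PIECE OF THE TRUNCATED FUNCTION IS THE CORNER SUM OF THE TRUNCATED FUNCTIONS OF THE SUB-REGION GASES**: for `X ⊆ W`,
`T^{fill X}[W-gas](K) = Σ_{X' ⊆ X} (−1)^{|X∖X'|} T[X'-gas](K)` when the connected series of the `X'`-gases, `X' ⊆ X`, converge (p36 g13
`TsumFill_eq_cornerSum` + `Tsum_vsupp_subfamily_eq`). [cite: BalabanImbrieJaffe1988, p.310 (Sect. 5.14)] -/
theorem TsumFill_vsupp_eq_cornerSum {X : Finset ι} (hXW : X ⊆ W) {K : Finset S}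
    (hs : ∀ X' ⊆ X, Summable fun m => Tord ((polysOf X').image (cvsupp adj X')) (locv loc) (wv g) m K) :
    TsumFill ((polysOf W).image (cvsupp adj W)) (locv loc) (wv g) cubesOf X K =
      cornerSum (fun X' => Tsum ((polysOf X').image (cvsupp adj X')) (locv loc) (wv g) K) X := by
  have hs' : ∀ X' ⊆ X, Summable fun m =>
      Tord (((polysOf W).image (cvsupp adj W)).filter fun Zv => cubesOf Zv ⊆ X') (locv loc) (wv g) m K := fun X' hX' => by
    rw [filter_vsupp_cubesOf_subset (hX'.trans hXW)]
    simpa only [Tord_vsupp_subfamily_eq (hX'.trans hXW)] using hs X' hX'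
  rw [TsumFill_eq_cornerSum _ _ _ _ hs']
  exact cornerSum_congr fun X' hX' => by
    rw [filter_vsupp_cubesOf_subset (hX'.trans hXW), Tsum_vsupp_subfamily_eq (hX'.trans hXW)]

end SubRegion

/-! ## §2 The standard exercise with `|X|`-decay, from an activity bound -/

section Decay

variable {ι : Type*} [DecidableEq ι] [Fintype ι] {S : Type*} [DecidableEq S] [Fintype S] {adj : ι → ι → Prop} [DecidableRel adj]
  {nbr : ι → Finset ι} {Δ : ℕ} {W : Finset ι} {loc : S → ι} {g : Finset S → Finset ι → ℝ}

omit [DecidableEq S] [Fintype S] in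
/-- the activity bound with a decay factor pulls back to the virtual supports: `|wv g (H, Z̃)| ≤ M^{|H|}·μ_σ(cubes Z̃)·q^{|cubes Z̃|}`.
[cite: BalabanImbrieJaffe1988, (5.14.4) p.309; p.310] -/
theorem abs_wv_le_decay {M σ q : ℝ} (hg0 : ∀ X ∈ polysOf W, ¬ IsRConnected adj X → ∀ H, g H X = 0)
    (hg : ∀ H : Finset S, ∀ X ∈ polysOf W, |g H X| ≤ M ^ H.card * (σ ^ X.card * q ^ X.card)) (H : Finset S) :
    ∀ Zv ∈ (polysOf W).image (cvsupp adj W), |wv g H Zv| ≤ M ^ H.card * (kpWeight adj σ (cubesOf Zv) * q ^ (cubesOf Zv).card) := by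
  intro Zv hZv
  obtain ⟨X, hX, rfl⟩ := mem_image.1 hZv
  rw [wv_vsupp, cubesOf_vsupp]
  by_cases hc : IsRConnected adj X
  · simp only [kpWeight, if_pos hc]
    exact hg H X hX
  · simp only [kpWeight, if_neg hc, hg0 X hX hc H, abs_zero, zero_mul, mul_zero, le_refl]

omit [DecidableEq S] [Fintype S] in
/-- **the vertex hypothesis on a sub-family** (fewer clusters than in p36 g11's `vertexHyp_vsupp`, nonnegative terms).
[cite: BalabanImbrieJaffe1988, p.310 (Sect. 5.14)] -/
theorem vertexHyp_vsupp_sub (hR : ∀ x y, adj x y → adj y x) (hΔ : ∀ x, (nbr x).card ≤ Δ) (hnbr : ∀ x y, adj x y → y ∈ nbr x)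
    {σ : ℝ} (hσ : 0 ≤ σ) (hsmall : ((Δ : ℝ) + 1) ^ 2 * (Real.exp 1 * σ) ≤ 1 / 2) (X : Finset ι) :
    ∀ Zv' ∈ ((polysOf W).image (cvsupp adj W)).filter (fun Zv => cubesOf Zv ⊆ X), ∀ k : ℕ,
      ∑ Zv ∈ ((polysOf W).image (cvsupp adj W)).filter (fun Zv => cubesOf Zv ⊆ X) with ¬ Disjoint Zv Zv',
          Real.exp 1 * kpWeight adj σ (cubesOf Zv) * ((cubesOf Zv).card : ℝ) ^ k ≤
        k.factorial * (2 * Real.exp 2 * σ * ((Δ : ℝ) + 1)) * ((cubesOf Zv').card : ℝ) := by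
  intro Zv' hZv' k
  refine le_trans ?_ (vertexHyp_vsupp (W := W) hR hΔ hnbr hσ hsmall Zv' (mem_filter.1 hZv').1 k)
  rw [filter_filter]
  refine sum_le_sum_of_subset_of_nonneg (fun Zv hZv => ?_) fun Zv _ _ =>
    mul_nonneg (mul_nonneg (Real.exp_nonneg 1) (kpWeight_nonneg adj hσ _)) (pow_nonneg (Nat.cast_nonneg _) _)
  simp only [mem_filter] at hZv ⊢
  exact ⟨hZv.1, hZv.2.2⟩

omit [DecidableEq S] [Fintype S] in
/-- **the root hypothesis on a sub-family, with the volume `|X|` of the sub-region** (every polymer of `X` touches `X`).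
[cite: BalabanImbrieJaffe1988, p.310 (Sect. 5.14)] -/
theorem rootHyp_vsupp_sub (hR : ∀ x y, adj x y → adj y x) (hΔ : ∀ x, (nbr x).card ≤ Δ)
    (hnbr : ∀ x y, adj x y → y ∈ nbr x) {σ : ℝ} (hσ : 0 ≤ σ) (hsmall : ((Δ : ℝ) + 1) ^ 2 * (Real.exp 1 * σ) ≤ 1 / 2) {X : Finset ι}
    (hXW : X ⊆ W) (k : ℕ) :
    ∑ Zv ∈ ((polysOf W).image (cvsupp adj W)).filter (fun Zv => cubesOf Zv ⊆ X),
        Real.exp 1 * kpWeight adj σ (cubesOf Zv) * ((cubesOf Zv).card : ℝ) ^ k ≤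
      k.factorial * (2 * Real.exp 2 * σ * ((Δ : ℝ) + 1)) * (X.card : ℝ) := by
  classical
  have h𝒩 : ∀ Y ∈ polysOf X, Y = X ∨ Touches adj X Y := fun Y hY => by
    obtain ⟨hYX, c, hc⟩ := mem_polysOf.1 hY
    exact Or.inr ⟨c, hYX hc, c, hc, Or.inl rfl⟩
  have he2 : Real.exp 2 = Real.exp 1 * Real.exp 1 := by rw [← Real.exp_add]; norm_num
  rw [filter_vsupp_cubesOf_subset hXW]
  calc ∑ Zv ∈ (polysOf X).image (cvsupp adj W), Real.exp 1 * kpWeight adj σ (cubesOf Zv) * ((cubesOf Zv).card : ℝ) ^ k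
      = ∑ Y ∈ polysOf X, Real.exp 1 * kpWeight adj σ Y * (Y.card : ℝ) ^ k := by
        rw [sum_image fun Y _ Y' _ h => vsupp_injective h]
        exact sum_congr rfl fun Y _ => by rw [cubesOf_vsupp]
    _ ≤ ∑ Y ∈ polysOf X, Real.exp 1 * (k.factorial * kpWeight adj (Real.exp 1 * σ) Y) :=
        sum_le_sum fun Y _ => by
          rw [mul_assoc]
          exact mul_le_mul_of_nonneg_left (kpWeight_mul_pow_le hσ Y k) (Real.exp_nonneg 1)
    _ = Real.exp 1 * k.factorial * ∑ Y ∈ polysOf X, kpWeight adj (Real.exp 1 * σ) Y := by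
        rw [mul_sum]
        exact sum_congr rfl fun _ _ => by ring
    _ ≤ Real.exp 1 * k.factorial * (X.card * ((Δ : ℝ) + 1) * (2 * (Real.exp 1 * σ))) :=
        mul_le_mul_of_nonneg_left (sum_kpWeight_le_of_touches hR hΔ hnbr (mul_nonneg (Real.exp_nonneg 1) hσ) hsmall X _ h𝒩)
          (by positivity)
    _ = k.factorial * (2 * Real.exp 2 * σ * ((Δ : ℝ) + 1)) * (X.card : ℝ) := by
        rw [he2]; ring

/-- **the connected series of every sub-region gas converges absolutely** (from the activity bound; `hT` for the `X`-gases, `X ⊆ W`).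
[cite: BalabanImbrieJaffe1988, p.310 (Sect. 5.14)] -/
theorem summable_norm_Tord_vsupp_sub (hR : ∀ x y, adj x y → adj y x) (hΔ : ∀ x, (nbr x).card ≤ Δ) (hnbr : ∀ x y, adj x y → y ∈ nbr x)
    {M σ q : ℝ} (hM : 0 ≤ M) (hσ : 0 ≤ σ) (hq0 : 0 ≤ q) (hq1 : q ≤ 1) (hsmall₁ : ((Δ : ℝ) + 1) ^ 2 * (Real.exp 1 * σ) ≤ 1 / 2)
    (hsmall₂ : 2 * Real.exp 2 * σ * ((Δ : ℝ) + 1) ≤ 1 / 8)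
    (hg0 : ∀ X ∈ polysOf W, ¬ IsRConnected adj X → ∀ H, g H X = 0)
    (hg : ∀ H : Finset S, ∀ X ∈ polysOf W, |g H X| ≤ M ^ H.card * (σ ^ X.card * q ^ X.card)) {X : Finset ι} (hXW : X ⊆ W)
    {b : Finset S} (hb : b.Nonempty) :
    Summable fun m => ‖Tord ((polysOf X).image (cvsupp adj X)) (locv loc) (wv g) m b‖ := by
  have hg' : ∀ H : Finset S, ∀ Zv ∈ ((polysOf W).image (cvsupp adj W)).filter (fun Zv => cubesOf Zv ⊆ X),
      |wv g H Zv| ≤ M ^ H.card * kpWeight adj σ (cubesOf Zv) := fun H Zv hZv => by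
    refine (abs_wv_le_decay hg0 hg H Zv (mem_filter.1 hZv).1).trans ?_
    exact mul_le_mul_of_nonneg_left (mul_le_of_le_one_right (kpWeight_nonneg adj hσ _) (pow_le_one₀ hq0 hq1)) (pow_nonneg hM _)
  have h := summable_norm_Tord_of_treeHyp (Q := ((polysOf W).image (cvsupp adj W)).filter fun Zv => cubesOf Zv ⊆ X) (loc := locv loc)
    (u := fun Zv => kpWeight adj σ (cubesOf Zv)) (vol := fun Zv => ((cubesOf Zv).card : ℝ)) hM (fun Zv => kpWeight_nonneg adj hσ _) hg'
    (fun _ _ => Nat.cast_nonneg _) (by positivity) (Nat.cast_nonneg _) hsmall₂ (vertexHyp_vsupp_sub hR hΔ hnbr hσ hsmall₁ X)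
    (rootHyp_vsupp_sub hR hΔ hnbr hσ hsmall₁ hXW) hb
  rw [filter_vsupp_cubesOf_subset hXW] at h
  simpa only [Tord_vsupp_subfamily_eq hXW] using h

/-- **THE `X`-PIECE OF THE TRUNCATED FUNCTION IS BOUNDED WITH THE DECAY `q^{|X|}`**: under the activity bound `|g(H,Y)| ≤ M^{|H|}·σ^{|Y|}·q^{|Y|}`
vanishing off connected polymers (`M, σ ≥ 0`, `0 ≤ q ≤ 1`, `(Δ+1)²eσ ≤ 1/2`, `2e²σ(Δ+1) ≤ 1/8`), for `X ⊆ W` and every nonempty block `b`: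
`|T^{fill X}(b)| ≤ q^{|X|}·M^{|b|}·|b|!·(4e²σ(Δ+1))·|X|`. [cite: BalabanImbrieJaffe1988, p.310 (Sect. 5.14)] -/
theorem abs_TsumFill_vsupp_le (hR : ∀ x y, adj x y → adj y x) (hΔ : ∀ x, (nbr x).card ≤ Δ) (hnbr : ∀ x y, adj x y → y ∈ nbr x)
    {M σ q : ℝ} (hM : 0 ≤ M) (hσ : 0 ≤ σ) (hq0 : 0 ≤ q) (hq1 : q ≤ 1) (hsmall₁ : ((Δ : ℝ) + 1) ^ 2 * (Real.exp 1 * σ) ≤ 1 / 2)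
    (hsmall₂ : 2 * Real.exp 2 * σ * ((Δ : ℝ) + 1) ≤ 1 / 8)
    (hg0 : ∀ X ∈ polysOf W, ¬ IsRConnected adj X → ∀ H, g H X = 0)
    (hg : ∀ H : Finset S, ∀ X ∈ polysOf W, |g H X| ≤ M ^ H.card * (σ ^ X.card * q ^ X.card)) {X : Finset ι} (hXW : X ⊆ W)
    {b : Finset S} (hb : b.Nonempty) :
    |TsumFill ((polysOf W).image (cvsupp adj W)) (locv loc) (wv g) cubesOf X b| ≤
      q ^ X.card * (M ^ b.card * b.card.factorial * (2 * (2 * Real.exp 2 * σ * ((Δ : ℝ) + 1)) * X.card)) :=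
  abs_TsumFill_le_of_treeHyp (u := fun Zv => kpWeight adj σ (cubesOf Zv)) (vol := fun Zv => ((cubesOf Zv).card : ℝ)) hM
    (fun Zv => kpWeight_nonneg adj hσ _) hq0 hq1 (fun H Zv hZv => abs_wv_le_decay hg0 hg H Zv hZv) X (fun _ _ => Nat.cast_nonneg _)
    (by positivity) (Nat.cast_nonneg _) hsmall₂ (vertexHyp_vsupp_sub hR hΔ hnbr hσ hsmall₁ X) (rootHyp_vsupp_sub hR hΔ hnbr hσ hsmall₁ hXW) hb

/-- … and the series of the `X`-piece converges absolutely. [cite: BalabanImbrieJaffe1988, p.310 (Sect. 5.14)] -/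
theorem summable_norm_TordFill_vsupp (hR : ∀ x y, adj x y → adj y x) (hΔ : ∀ x, (nbr x).card ≤ Δ) (hnbr : ∀ x y, adj x y → y ∈ nbr x)
    {M σ q : ℝ} (hM : 0 ≤ M) (hσ : 0 ≤ σ) (hq0 : 0 ≤ q) (hq1 : q ≤ 1) (hsmall₁ : ((Δ : ℝ) + 1) ^ 2 * (Real.exp 1 * σ) ≤ 1 / 2)
    (hsmall₂ : 2 * Real.exp 2 * σ * ((Δ : ℝ) + 1) ≤ 1 / 8)
    (hg0 : ∀ X ∈ polysOf W, ¬ IsRConnected adj X → ∀ H, g H X = 0)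
    (hg : ∀ H : Finset S, ∀ X ∈ polysOf W, |g H X| ≤ M ^ H.card * (σ ^ X.card * q ^ X.card)) {X : Finset ι} (hXW : X ⊆ W)
    {b : Finset S} (hb : b.Nonempty) :
    Summable fun m => ‖TordFill ((polysOf W).image (cvsupp adj W)) (locv loc) (wv g) cubesOf X m b‖ :=
  summable_norm_TordFill_of_treeHyp (u := fun Zv => kpWeight adj σ (cubesOf Zv)) (vol := fun Zv => ((cubesOf Zv).card : ℝ)) hM
    (fun Zv => kpWeight_nonneg adj hσ _) hq0 hq1 (fun H Zv hZv => abs_wv_le_decay hg0 hg H Zv hZv) X (fun _ _ => Nat.cast_nonneg _)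
    (by positivity) (Nat.cast_nonneg _) hsmall₂ (vertexHyp_vsupp_sub hR hΔ hnbr hσ hsmall₁ X) (rootHyp_vsupp_sub hR hΔ hnbr hσ hsmall₁ hXW) hb

end Decay

/-! ## §3 From the typed leaf (5.14.4) in gen 5's regime -/

section Leaf

variable {ι : Type} [DecidableEq ι] [Fintype ι] {S : Type} [DecidableEq S] [Fintype S] {adj : ι → ι → Prop} [DecidableRel adj]
  {nbr : ι → Finset ι} {Δ : ℕ} {W : Finset ι} {loc : S → ι} {zr : Finset S → Finset ι → Finset ι → ℝ} {θ β' : ℝ}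

omit [Fintype ι] [Fintype S] in
/-- **(5.14.4) ⟹ the activity-bound shape with the decay split off**: `|g₃′(H, X)| ≤ (θ^{1−β′})^{|H|}·((θ^{β′/2})^{|X|}·(θ^{β′/2})^{|X|})`
(`θ^{β′} = (θ^{β′/2})²`). [cite: BalabanImbrieJaffe1988, (5.14.4) p.309] -/
theorem abs_prime_g3_le_of_ineq5144_half (hθ0 : 0 < θ) (hθ1 : θ ≤ 1) (hβ : 0 ≤ β')
    (h : Ineq5144 (cubeSys ι) (Finset S) (prime (g3 adj zr)) Finset.card (fun H (X : Finset ι) => (X \ H.image loc).card) θ β')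
    (H : Finset S) (X : Finset ι) :
    |prime (g3 adj zr) H X| ≤ (θ ^ (1 - β')) ^ H.card * ((θ ^ (β' / 2)) ^ X.card * (θ ^ (β' / 2)) ^ X.card) := by
  refine (abs_prime_g3_le_of_ineq5144 hθ0 hθ1 hβ h H X).trans (le_of_eq ?_)
  rw [← mul_pow, ← Real.rpow_add hθ0]
  norm_num

omit [DecidableEq ι] [Fintype ι] [DecidableEq S] [Fintype S] [DecidableRel adj] in
/-- **gen 5's regime gives the two smallness constants for `σ = θ^{β′/2}`**: `16(Δ+1)²θ^{β′/2}e² ≤ 1` implies `(Δ+1)²·eθ^{β′/2} ≤ 1/2` and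
`2e²θ^{β′/2}(Δ+1) ≤ 1/8` (`e ≤ e²`, `Δ+1 ≤ (Δ+1)²`). [cite: BalabanImbrieJaffe1988, p.310 (Sect. 5.14)] -/
theorem regime_split_half (hθ0 : 0 < θ) (hsmall : 16 * ((Δ : ℝ) + 1) ^ 2 * (θ ^ (β' / 2) * Real.exp 2) ≤ 1) :
    ((Δ : ℝ) + 1) ^ 2 * (Real.exp 1 * θ ^ (β' / 2)) ≤ 1 / 2 ∧ 2 * Real.exp 2 * θ ^ (β' / 2) * ((Δ : ℝ) + 1) ≤ 1 / 8 := by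
  set u : ℝ := θ ^ (β' / 2) with hu
  have hu0 : 0 ≤ u := Real.rpow_nonneg hθ0.le _
  have he1 : (1 : ℝ) ≤ Real.exp 1 := Real.one_le_exp (by norm_num)
  have he : Real.exp 1 ≤ Real.exp 2 := Real.exp_le_exp.2 (by norm_num)
  have he0 : 0 ≤ Real.exp 2 := Real.exp_nonneg _
  have hD1 : (1 : ℝ) ≤ (Δ : ℝ) + 1 := by linarith [(Nat.cast_nonneg Δ : (0 : ℝ) ≤ Δ)]
  have hD : (Δ : ℝ) + 1 ≤ ((Δ : ℝ) + 1) ^ 2 := by nlinarith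
  have h1 : ((Δ : ℝ) + 1) ^ 2 * u * Real.exp 2 ≤ 1 / 16 := by linarith [hsmall]
  constructor
  · calc ((Δ : ℝ) + 1) ^ 2 * (Real.exp 1 * u) ≤ ((Δ : ℝ) + 1) ^ 2 * (Real.exp 2 * u) := by gcongr
      _ = ((Δ : ℝ) + 1) ^ 2 * u * Real.exp 2 := by ring
      _ ≤ 1 / 2 := by linarith
  · calc 2 * Real.exp 2 * u * ((Δ : ℝ) + 1) ≤ 2 * Real.exp 2 * u * ((Δ : ℝ) + 1) ^ 2 := by gcongr
      _ = 2 * (((Δ : ℝ) + 1) ^ 2 * u * Real.exp 2) := by ring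
      _ ≤ 1 / 8 := by linarith

/-- **`hT` OF EVERY SUB-REGION GAS FROM (5.14.4)**: in gen 5's regime the connected series of the `X`-gas, `X ⊆ W`, converges absolutely for the
prime-dropped activities of real corner data `zr` obeying the leaf. [cite: BalabanImbrieJaffe1988, (5.14.4) p.309, p.310 (Sect. 5.14)] -/
theorem summable_norm_Tord_vsupp_sub_of_ineq5144 (hR : ∀ x y, adj x y → adj y x) (hΔ : ∀ x, (nbr x).card ≤ Δ)
    (hnbr : ∀ x y, adj x y → y ∈ nbr x) (hθ0 : 0 < θ) (hθ1 : θ ≤ 1) (hβ : 0 ≤ β')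
    (hsmall : 16 * ((Δ : ℝ) + 1) ^ 2 * (θ ^ (β' / 2) * Real.exp 2) ≤ 1)
    (h : Ineq5144 (cubeSys ι) (Finset S) (prime (g3 adj zr)) Finset.card (fun H (X : Finset ι) => (X \ H.image loc).card) θ β')
    {X : Finset ι} (hXW : X ⊆ W) {b : Finset S} (hb : b.Nonempty) :
    Summable fun m => ‖Tord ((polysOf X).image (cvsupp adj X)) (locv loc) (wv (prime (g3 adj zr))) m b‖ :=
  have hs := regime_split_half (Δ := Δ) (β' := β') hθ0 hsmall
  summable_norm_Tord_vsupp_sub (W := W) hR hΔ hnbr (Real.rpow_nonneg hθ0.le _) (Real.rpow_nonneg hθ0.le _) (Real.rpow_nonneg hθ0.le _)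
    (Real.rpow_le_one hθ0.le hθ1 (by linarith)) hs.1 hs.2 (fun _ hX hc H => prime_g3_eq_zero_of_not_isRConnected hR hX hc H)
    (fun H X _ => abs_prime_g3_le_of_ineq5144_half hθ0 hθ1 hβ h H X) hXW hb

/-- **THE `X`-PIECE AS A CORNER SUM OF SUB-REGION TRUNCATED FUNCTIONS, MODULO (5.14.4)**: for `X ⊆ W` and a nonempty block `K`,
`T^{fill X}[W-gas](K) = Σ_{X' ⊆ X} (−1)^{|X∖X'|} T[X'-gas](K)`. [cite: BalabanImbrieJaffe1988, p.310 (Sect. 5.14); (5.14.4) p.309] -/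
theorem TsumFill_vsupp_eq_cornerSum_of_ineq5144 (hR : ∀ x y, adj x y → adj y x) (hΔ : ∀ x, (nbr x).card ≤ Δ)
    (hnbr : ∀ x y, adj x y → y ∈ nbr x) (hθ0 : 0 < θ) (hθ1 : θ ≤ 1) (hβ : 0 ≤ β')
    (hsmall : 16 * ((Δ : ℝ) + 1) ^ 2 * (θ ^ (β' / 2) * Real.exp 2) ≤ 1)
    (h : Ineq5144 (cubeSys ι) (Finset S) (prime (g3 adj zr)) Finset.card (fun H (X : Finset ι) => (X \ H.image loc).card) θ β')
    {X : Finset ι} (hXW : X ⊆ W) {K : Finset S} (hK : K.Nonempty) :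
    TsumFill ((polysOf W).image (cvsupp adj W)) (locv loc) (wv (prime (g3 adj zr))) cubesOf X K =
      cornerSum (fun X' => Tsum ((polysOf X').image (cvsupp adj X')) (locv loc) (wv (prime (g3 adj zr))) K) X :=
  TsumFill_vsupp_eq_cornerSum hXW fun _ hX' =>
    (summable_norm_Tord_vsupp_sub_of_ineq5144 (W := W) hR hΔ hnbr hθ0 hθ1 hβ hsmall h (hX'.trans hXW) hK).of_norm

/-- **THE `|X|`-DECAY OF THE PRINTED "RESULT" IN THE BOOKKEEPING OF RECORD, MODULO (5.14.4)**: for `X ⊆ W` and every nonempty block `b`,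
`|T^{fill X}(b)| ≤ (θ^{β′/2})^{|X|}·(θ^{1−β′})^{|b|}·|b|!·(4e²θ^{β′/2}(Δ+1))·|X|` (p. 310: *"The result is |W₆^{(k)′}(X)| ≤
(e^β(L^kε/ε₀)^{1/4−α})^{n̄+1+β′|X|}"*, before the `t`-integration and the assignment count). [cite: BalabanImbrieJaffe1988, p.310 (Sect. 5.14); (5.14.4) p.309] -/
theorem abs_TsumFill_vsupp_le_of_ineq5144 (hR : ∀ x y, adj x y → adj y x) (hΔ : ∀ x, (nbr x).card ≤ Δ)
    (hnbr : ∀ x y, adj x y → y ∈ nbr x) (hθ0 : 0 < θ) (hθ1 : θ ≤ 1) (hβ : 0 ≤ β')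
    (hsmall : 16 * ((Δ : ℝ) + 1) ^ 2 * (θ ^ (β' / 2) * Real.exp 2) ≤ 1)
    (h : Ineq5144 (cubeSys ι) (Finset S) (prime (g3 adj zr)) Finset.card (fun H (X : Finset ι) => (X \ H.image loc).card) θ β')
    {X : Finset ι} (hXW : X ⊆ W) {b : Finset S} (hb : b.Nonempty) :
    |TsumFill ((polysOf W).image (cvsupp adj W)) (locv loc) (wv (prime (g3 adj zr))) cubesOf X b| ≤
      (θ ^ (β' / 2)) ^ X.card * ((θ ^ (1 - β')) ^ b.card * b.card.factorial *
        (2 * (2 * Real.exp 2 * θ ^ (β' / 2) * ((Δ : ℝ) + 1)) * X.card)) :=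
  have hs := regime_split_half (Δ := Δ) (β' := β') hθ0 hsmall
  abs_TsumFill_vsupp_le (W := W) hR hΔ hnbr (Real.rpow_nonneg hθ0.le _) (Real.rpow_nonneg hθ0.le _) (Real.rpow_nonneg hθ0.le _)
    (Real.rpow_le_one hθ0.le hθ1 (by linarith)) hs.1 hs.2 (fun _ hX hc H => prime_g3_eq_zero_of_not_isRConnected hR hX hc H)
    (fun H X _ => abs_prime_g3_le_of_ineq5144_half hθ0 hθ1 hβ h H X) hXW hb

/-- … and the series of the `X`-piece converges absolutely, modulo (5.14.4). [cite: BalabanImbrieJaffe1988, p.310 (Sect. 5.14); (5.14.4) p.309] -/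
theorem summable_norm_TordFill_vsupp_of_ineq5144 (hR : ∀ x y, adj x y → adj y x) (hΔ : ∀ x, (nbr x).card ≤ Δ)
    (hnbr : ∀ x y, adj x y → y ∈ nbr x) (hθ0 : 0 < θ) (hθ1 : θ ≤ 1) (hβ : 0 ≤ β')
    (hsmall : 16 * ((Δ : ℝ) + 1) ^ 2 * (θ ^ (β' / 2) * Real.exp 2) ≤ 1)
    (h : Ineq5144 (cubeSys ι) (Finset S) (prime (g3 adj zr)) Finset.card (fun H (X : Finset ι) => (X \ H.image loc).card) θ β')
    {X : Finset ι} (hXW : X ⊆ W) {b : Finset S} (hb : b.Nonempty) :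
    Summable fun m => ‖TordFill ((polysOf W).image (cvsupp adj W)) (locv loc) (wv (prime (g3 adj zr))) cubesOf X m b‖ :=
  have hs := regime_split_half (Δ := Δ) (β' := β') hθ0 hsmall
  summable_norm_TordFill_vsupp (W := W) hR hΔ hnbr (Real.rpow_nonneg hθ0.le _) (Real.rpow_nonneg hθ0.le _) (Real.rpow_nonneg hθ0.le _)
    (Real.rpow_le_one hθ0.le hθ1 (by linarith)) hs.1 hs.2 (fun _ hX hc H => prime_g3_eq_zero_of_not_isRConnected hR hX hc H)
    (fun H X _ => abs_prime_g3_le_of_ineq5144_half hθ0 hθ1 hβ h H X) hXW hb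

end Leaf

end Literature.MathematicalPhysics.QuantumFieldTheory.BalabanImbrieJaffe1984to88.BIJ88ConnectedGraphFillingVsupp

end
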